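import Mathlib
import Literature.Analysis.FunctionSpaces.TorusFluidGlueProofs
import Literature.Analysis.FunctionSpaces.TorusLinearisedFormTruncation
import Literature.Analysis.FluidPDE.CheskidovAssemblyTools
import Literature.Analysis.FluidPDE.TorusClassicalHnBalance
import Literature.Analysis.FluidPDE.TorusABCFlow
import HarnessLib

/-!
# The laminar dissipation ceiling of forced Navier–Stokes on the torus: over any window on which
# the energy does not decrease, the mean dissipation rate is at most the Stokes value `F²/(4π²ν)`
(profile-eng-6 g4, cell `ns-blowup`, GROUP B zone Z4 «engine G» twin seat, 2026-08-26)

HONEST FRAMING (human ruling D-0035): nothing here is a claim about Navier–Stokes blow-up.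
WHAT THIS IS NOT: not NS blow-up evidence; not a statement about any tower, episode or orbit. It is
the second elementary companion of the tree's absorbing ball
`Summit.NavierStokesRegularity.FluidComputer.ForcedEnergyBall.sqrt_integral_norm_sq_le_max` and of
the rebuild floor `Summit.NavierStokesRegularity.FluidComputer.ForcedEnergyRebuildFloor`: a
TIME-AVERAGED bound. For a classical solution `(u, p)` of `∂ₜu + (u·∇)u = νΔu − ∇p + f` on the unit
torus `T^d = ℝ^d/ℤ^d` with mean-zero velocity slices and `‖f(t)‖_{L²} ≤ F` on `[a, b]`, the energy
balance `dE/dt = −ν‖∇u‖₂² + ∫⟪f, u⟫` (`Torus.IsClassicalNSSolutionOn.energy_balance_holds`), Poincaré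
`4π²∫‖u‖² ≤ ‖∇u‖₂²` (`Torus.four_pi_sq_mul_integral_norm_sq_le_gradNormSq`), Cauchy–Schwarz and the
arithmetic–geometric mean inequality `F·‖∇u‖₂/(2π) ≤ (ν/2)‖∇u‖₂² + F²/(8π²ν)` give the pointwise
slope bound `dE/dt ≤ −(ν/2)‖∇u‖₂² + F²/(8π²ν)`; integrating it with Mathlib's
`intervalIntegral.integral_le_sub_of_hasDeriv_right_of_le` (the `H¹` balance
`Torus.IsClassicalNSSolutionOn.hasDerivWithinAt_half_gradNormSq` supplies the continuity, hence
integrability, of `t ↦ ‖∇u(t)‖₂²`):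

* `mul_div_le_half_mul_sq_add` — the scalar AM–GM step `F·(x/(2π)) ≤ (ν/2)x² + F²/(8π²ν)`;
* `nu_mul_integral_gradNormSq_le` — the WINDOW BUDGET
  `ν ∫ₐᵇ ‖∇u(t)‖₂² dt ≤ (‖u(a)‖₂² − ‖u(b)‖₂²) + (b − a)·F²/(4π²ν)`;
* `nu_mul_integral_gradNormSq_le_of_sq_norm_le` — if `‖u(a)‖₂ ≤ ‖u(b)‖₂` (the energy does not
  decrease over the window — e.g. ONE PERIOD of a time-periodic solution, or any two equal-energy
  instants) then `ν ∫ₐᵇ ‖∇u‖₂² ≤ (b − a)·F²/(4π²ν)`: the MEAN DISSIPATION RATE over the window is at most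
  the Stokes/laminar value `F²/(4π²ν)` — the rate of the steady Stokes flow driven by a first-shell
  force of size `F` (Doering–Foias 2002 §2: the laminar bound, saturated by first-shell forcing);
* `nu_mul_integral_gradNormSq_le_of_periodic` — the same under `u b = u a`;
* `nu_mul_integral_gradNormSq_le_host` — HOST form: if `‖f(t)‖_{L²} ≤ 4π²ν·R` then
  `ν ∫ₐᵇ ‖∇u‖₂² ≤ (b − a)·ν·(4π² R²)`;
* `gradNormSq_abcFlow` — for the ABC flow `U = Torus.abcFlow A B C` on `T³`,
  `‖∇U‖₂² = 4π²(A² + B² + C²) = 4π²‖U‖₂²` (first Stokes shell: `ΔU = −4π²U`,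
  `Torus.laplacian_abcFlow`, Green `Torus.integral_inner_laplacian_self_eq_neg_gradNormSq`);
* `nu_mul_integral_gradNormSq_le_abc` — the ABC instance: for every classical solution of the
  Navier–Stokes system on `T³` forced by the ABC host force `f = (ν·4π²)•U`
  (`Torus.isClassicalNSSolutionOn_abcFlow_forced`: `U` itself is the steady solution) and every
  window `[a, b]` over which `‖u‖₂` does not decrease,
  `ν ∫ₐᵇ ‖∇u(t)‖₂² dt ≤ (b − a)·ν‖∇U‖₂²` — NO RECURRENT STATE OF THE FORCED-ABC FLOW DISSIPATES MORE,
  ON AVERAGE, THAN THE LAMINAR ABC FLOW ITSELF (equality for `u ≡ U`).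

MODEL READING (GROUP B zone Z4, PROFILE-SPEC v1.2 §6.3 (r10-3) E-row, lead RULINGS (bw)(3)/(cb)(3);
a DESIGN-DICTIONARY sentence for the `EpisodeBase` stub `host_preparation`, never an instance of it).
In the cell's code units (torus `[0, 2π)³`, host wavenumber 1, `f = νU_ABC`, `ν = 1/R`) the theorem
reads: on every (pre-)periodic orbit — more generally between any two equal-energy instants — of the
forced-ABC system, `⟨ε_D⟩_T := ⟨ν‖∇u‖²⟩_T ≤ ν‖∇U_ABC‖² = ε_D(U) = 3ν`, i.e. `⟨Z/Z_U⟩_T ≤ 1`, and with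
the booked identity `⟨a⟩_T = ⟨Z/Z_U⟩_T` ((cb)(3): mean projection on `U` = mean relative enstrophy on
any periodic orbit) also `⟨a⟩_T ≤ 1`. The two-engine E-row of the Z4-b calibration orbit (kit
j257870 engine G / j257977 engine A) printed `⟨Z/Z_U⟩_T = ⟨a⟩_T = 0.209080`, inside this ceiling by
a factor `4.8`. The cell's MODEL system is the cube-Galerkin truncation; the theorems below are
about the untruncated forced Navier–Stokes system on `T^d` (the Galerkin system obeys the same three
ingredients — exact energy identity, Poincaré on mean-zero modes, Cauchy–Schwarz — so the same
ceiling holds there by the same three lines; that finite-dimensional statement is not typed here).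
WHAT THE MODEL READING IS NOT: not NS (forced `T³` flow, `f = νU_ABC` not Clay-class).

Mathlib + Literature only; theorems only, no new definitions.
-/

noncomputable section

namespace Summit.NavierStokesRegularity.FluidComputer.ForcedDissipationCeiling

open Set Filter MeasureTheory Literature.Analysis.FunctionSpaces Literature.Analysis.FunctionSpaces.Torus
open scoped InnerProductSpace Topology

variable {d : Type*} [Fintype d] [DecidableEq d]

/-- **AM–GM step.** For `ν > 0` and all real `F, x`: `F·(x/(2π)) ≤ (ν/2)·x² + F²/(8π²ν)`
(the difference is `(ν/2)·(x − F/(2πν))²`). -/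
theorem mul_div_le_half_mul_sq_add {ν : ℝ} (hν : 0 < ν) (F x : ℝ) :
    F * (x / (2 * Real.pi)) ≤ ν / 2 * x ^ 2 + F ^ 2 / (8 * Real.pi ^ 2 * ν) := by
  have hπ : 0 < Real.pi := Real.pi_pos
  have hkey : ν / 2 * x ^ 2 + F ^ 2 / (8 * Real.pi ^ 2 * ν) - F * (x / (2 * Real.pi)) =
      ν / 2 * (x - F / (2 * Real.pi * ν)) ^ 2 := by
    field_simp
    ring
  have hsq : 0 ≤ ν / 2 * (x - F / (2 * Real.pi * ν)) ^ 2 :=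
    mul_nonneg (by positivity) (sq_nonneg _)
  linarith [hkey, hsq]

/-- **The window budget of forced Navier–Stokes on `T^d`.** Let `(u, p)` solve
`∂ₜu + (u·∇)u = νΔu − ∇p + f` classically on `[a, b] × T^d`, `a < b`, `ν > 0`, with mean-zero
velocity slices, smooth force slices and `‖f(t)‖_{L²} ≤ F` on `[a, b]`. Then
`ν ∫ₐᵇ ‖∇u(t)‖₂² dt ≤ (‖u(a)‖₂² − ‖u(b)‖₂²) + (b − a)·F²/(4π²ν)`.
(Energy balance, Poincaré, Cauchy–Schwarz, AM–GM: `dE/dt ≤ −(ν/2)‖∇u‖₂² + F²/(8π²ν)`, integrated.) -/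
theorem nu_mul_integral_gradNormSq_le {ν a b F : ℝ} (hν : 0 < ν) (hab : a < b)
    {f u : ℝ → UnitAddTorus d → EuclideanSpace ℝ d} {p : ℝ → UnitAddTorus d → ℝ}
    (h : IsClassicalNSSolutionOn (Icc a b) ν f u p)
    (h0 : ∀ t ∈ Icc a b, HasZeroMean (u t)) (hf : ∀ t ∈ Icc a b, IsSmooth (f t))
    (hF : ∀ t ∈ Icc a b, Real.sqrt (∫ x, ‖f t x‖ ^ 2) ≤ F) :
    ν * ∫ t in a..b, gradNormSq (u t) ≤
      ((∫ x, ‖u a x‖ ^ 2) - ∫ x, ‖u b x‖ ^ 2) + (b - a) * F ^ 2 / (4 * Real.pi ^ 2 * ν) := by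
  have hπ : 0 < Real.pi := Real.pi_pos
  set c : ℝ := F ^ 2 / (8 * Real.pi ^ 2 * ν) with hc
  -- the energy and its one-sided derivative from the energy balance
  set E : ℝ → ℝ := fun s => kineticEnergy (u s) with hEdef
  set E' : ℝ → ℝ := fun s => -ν * gradNormSq (u s) + ∫ x, ⟪f s x, u s x⟫_ℝ with hE'def
  have hder : ∀ s ∈ Icc a b, HasDerivWithinAt E (E' s) (Icc a b) s := fun s hs =>
    IsClassicalNSSolutionOn.energy_balance_holds h (convex_Icc a b) hs
  -- pointwise slope bound `E' ≤ -(ν/2)‖∇u‖² + c`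
  have hpt : ∀ s ∈ Icc a b, E' s ≤ -(ν / 2) * gradNormSq (u s) + c := by
    intro s hs
    have hus : IsSmooth (u s) := h.smooth_velocity.isSmooth_slice hs
    set L : ℝ := Real.sqrt (∫ x, ‖u s x‖ ^ 2) with hL
    have hI0 : 0 ≤ ∫ x, ‖u s x‖ ^ 2 := integral_nonneg fun _ => sq_nonneg _
    have hL2 : L ^ 2 = ∫ x, ‖u s x‖ ^ 2 := Real.sq_sqrt hI0
    have hL0 : 0 ≤ L := Real.sqrt_nonneg _
    -- Poincaré
    have hP : 4 * Real.pi ^ 2 * L ^ 2 ≤ gradNormSq (u s) := by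
      rw [hL2]; exact four_pi_sq_mul_integral_norm_sq_le_gradNormSq hus (h0 s hs)
    have hG0 : 0 ≤ gradNormSq (u s) := le_trans (by positivity) hP
    -- `L ≤ ‖∇u‖/(2π)`
    have hLG : L ≤ Real.sqrt (gradNormSq (u s)) / (2 * Real.pi) := by
      rw [le_div_iff₀ (by positivity)]
      have h1 : (L * (2 * Real.pi)) ^ 2 ≤ gradNormSq (u s) := by nlinarith [hP]
      calc L * (2 * Real.pi) = Real.sqrt ((L * (2 * Real.pi)) ^ 2) :=
            (Real.sqrt_sq (by positivity)).symm
        _ ≤ Real.sqrt (gradNormSq (u s)) := Real.sqrt_le_sqrt h1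
    -- Cauchy–Schwarz
    have hCS : ∫ x, ⟪f s x, u s x⟫_ℝ ≤ F * L := by
      have h1 := Literature.Analysis.FluidPDE.abs_integral_inner_le_sqrt_mul_sqrt
        ((hf s hs).memLp 2) (hus.memLp 2)
      exact (le_abs_self _).trans (h1.trans (mul_le_mul_of_nonneg_right (hF s hs) hL0))
    have hF0 : 0 ≤ F := (Real.sqrt_nonneg _).trans (hF s hs)
    have h2 : F * L ≤ F * (Real.sqrt (gradNormSq (u s)) / (2 * Real.pi)) :=
      mul_le_mul_of_nonneg_left hLG hF0
    have h3 := mul_div_le_half_mul_sq_add hν F (Real.sqrt (gradNormSq (u s)))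
    rw [Real.sq_sqrt hG0] at h3
    calc E' s = -ν * gradNormSq (u s) + ∫ x, ⟪f s x, u s x⟫_ℝ := rfl
      _ ≤ -ν * gradNormSq (u s) + (ν / 2 * gradNormSq (u s) + c) := by linarith [hCS, h2, h3]
      _ = -(ν / 2) * gradNormSq (u s) + c := by ring
  -- comparison function `g s = (2/ν)·(c·s − E s)`, `g' = (2/ν)·(c − E')`, `‖∇u‖² ≤ g'`
  set g : ℝ → ℝ := fun s => 2 / ν * (c * s - E s) with hg
  have hg' : ∀ s ∈ Icc a b, HasDerivWithinAt g (2 / ν * (c - E' s)) (Icc a b) s := by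
    intro s hs
    have h1 : HasDerivWithinAt (fun r => c * r) (c * 1) (Icc a b) s :=
      (hasDerivWithinAt_id s (Icc a b)).const_mul c
    rw [mul_one] at h1
    exact (h1.sub (hder s hs)).const_mul (2 / ν)
  have hcont : ContinuousOn g (Icc a b) := fun s hs => (hg' s hs).continuousWithinAt
  have hderiv : ∀ s ∈ Ioo a b, HasDerivWithinAt g (2 / ν * (c - E' s)) (Ioi s) s := fun s hs =>
    ((hg' s (Ioo_subset_Icc_self hs)).hasDerivAt (Icc_mem_nhds hs.1 hs.2)).hasDerivWithinAt
  -- integrability of `t ↦ ‖∇u(t)‖₂²` from the `H¹` balance (continuity on `[a, b]`)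
  have hGc : ContinuousOn (fun s => gradNormSq (u s)) (Icc a b) := by
    intro s hs
    have h1 : ContinuousWithinAt (fun r => (2 : ℝ) * (2⁻¹ * gradNormSq (u r))) (Icc a b) s :=
      continuousWithinAt_const.mul
        (Literature.Analysis.FunctionSpaces.Torus.IsClassicalNSSolutionOn.hasDerivWithinAt_half_gradNormSq
          h hab hs).continuousWithinAt
    refine h1.congr (fun r _ => ?_) ?_ <;> ring
  have hφint : IntegrableOn (fun s => gradNormSq (u s)) (Icc a b) volume :=
    hGc.integrableOn_Icc
  have hle : ∀ s ∈ Ioo a b, gradNormSq (u s) ≤ 2 / ν * (c - E' s) := by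
    intro s hs
    have h1 := hpt s (Ioo_subset_Icc_self hs)
    have h2 : ν / 2 * gradNormSq (u s) ≤ c - E' s := by linarith
    calc gradNormSq (u s) = 2 / ν * (ν / 2 * gradNormSq (u s)) := by
          field_simp
      _ ≤ 2 / ν * (c - E' s) := mul_le_mul_of_nonneg_left h2 (by positivity)
  have hmain := intervalIntegral.integral_le_sub_of_hasDeriv_right_of_le hab.le hcont hderiv
    hφint hle
  -- unfold `g b − g a`
  have hEa : E a = 2⁻¹ * ∫ x, ‖u a x‖ ^ 2 := rfl
  have hEb : E b = 2⁻¹ * ∫ x, ‖u b x‖ ^ 2 := rfl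
  have hgba : ν * (g b - g a) =
      ((∫ x, ‖u a x‖ ^ 2) - ∫ x, ‖u b x‖ ^ 2) + (b - a) * F ^ 2 / (4 * Real.pi ^ 2 * ν) := by
    simp only [hg, hEa, hEb, hc]
    field_simp
    ring
  calc ν * ∫ t in a..b, gradNormSq (u t) ≤ ν * (g b - g a) :=
        mul_le_mul_of_nonneg_left hmain hν.le
    _ = ((∫ x, ‖u a x‖ ^ 2) - ∫ x, ‖u b x‖ ^ 2) + (b - a) * F ^ 2 / (4 * Real.pi ^ 2 * ν) := hgba

/-- **Laminar dissipation ceiling on an energy-non-decreasing window.** Under the hypotheses of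
`nu_mul_integral_gradNormSq_le`, if `‖u(a)‖₂² ≤ ‖u(b)‖₂²` then
`ν ∫ₐᵇ ‖∇u(t)‖₂² dt ≤ (b − a)·F²/(4π²ν)`: the mean dissipation rate over the window is at most the
Stokes value `F²/(4π²ν)`. -/
theorem nu_mul_integral_gradNormSq_le_of_sq_norm_le {ν a b F : ℝ} (hν : 0 < ν) (hab : a < b)
    {f u : ℝ → UnitAddTorus d → EuclideanSpace ℝ d} {p : ℝ → UnitAddTorus d → ℝ}
    (h : IsClassicalNSSolutionOn (Icc a b) ν f u p)
    (h0 : ∀ t ∈ Icc a b, HasZeroMean (u t)) (hf : ∀ t ∈ Icc a b, IsSmooth (f t))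
    (hF : ∀ t ∈ Icc a b, Real.sqrt (∫ x, ‖f t x‖ ^ 2) ≤ F)
    (hE : ∫ x, ‖u a x‖ ^ 2 ≤ ∫ x, ‖u b x‖ ^ 2) :
    ν * ∫ t in a..b, gradNormSq (u t) ≤ (b - a) * F ^ 2 / (4 * Real.pi ^ 2 * ν) := by
  have h1 := nu_mul_integral_gradNormSq_le hν hab h h0 hf hF
  linarith

/-- **Laminar dissipation ceiling over a period.** Under the hypotheses of
`nu_mul_integral_gradNormSq_le`, if `u b = u a` (e.g. `[a, b]` is one period of a time-periodic
classical solution) then `ν ∫ₐᵇ ‖∇u(t)‖₂² dt ≤ (b − a)·F²/(4π²ν)`. -/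
theorem nu_mul_integral_gradNormSq_le_of_periodic {ν a b F : ℝ} (hν : 0 < ν) (hab : a < b)
    {f u : ℝ → UnitAddTorus d → EuclideanSpace ℝ d} {p : ℝ → UnitAddTorus d → ℝ}
    (h : IsClassicalNSSolutionOn (Icc a b) ν f u p)
    (h0 : ∀ t ∈ Icc a b, HasZeroMean (u t)) (hf : ∀ t ∈ Icc a b, IsSmooth (f t))
    (hF : ∀ t ∈ Icc a b, Real.sqrt (∫ x, ‖f t x‖ ^ 2) ≤ F) (hper : u b = u a) :
    ν * ∫ t in a..b, gradNormSq (u t) ≤ (b - a) * F ^ 2 / (4 * Real.pi ^ 2 * ν) :=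
  nu_mul_integral_gradNormSq_le_of_sq_norm_le hν hab h h0 hf hF (by rw [hper])

/-- **Host form.** Under the hypotheses of `nu_mul_integral_gradNormSq_le` with the force bound
written as `‖f(t)‖_{L²} ≤ 4π²ν·R` (`R ≥ 0`; e.g. `f = (4π²ν)•U` for a first-shell host `U` with
`‖U‖₂ = R`, such as the ABC flow), on an energy-non-decreasing window
`ν ∫ₐᵇ ‖∇u(t)‖₂² dt ≤ (b − a)·ν·(4π²R²)` — and `4π²R² = ‖∇U‖₂²` for such a host
(`gradNormSq_abcFlow`). -/
theorem nu_mul_integral_gradNormSq_le_host {ν a b R : ℝ} (hν : 0 < ν) (hab : a < b)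
    {f u : ℝ → UnitAddTorus d → EuclideanSpace ℝ d} {p : ℝ → UnitAddTorus d → ℝ}
    (h : IsClassicalNSSolutionOn (Icc a b) ν f u p)
    (h0 : ∀ t ∈ Icc a b, HasZeroMean (u t)) (hf : ∀ t ∈ Icc a b, IsSmooth (f t))
    (hF : ∀ t ∈ Icc a b, Real.sqrt (∫ x, ‖f t x‖ ^ 2) ≤ 4 * Real.pi ^ 2 * ν * R)
    (hE : ∫ x, ‖u a x‖ ^ 2 ≤ ∫ x, ‖u b x‖ ^ 2) :
    ν * ∫ t in a..b, gradNormSq (u t) ≤ (b - a) * (ν * (4 * Real.pi ^ 2 * R ^ 2)) := by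
  have hπ : 0 < Real.pi := Real.pi_pos
  have h1 := nu_mul_integral_gradNormSq_le_of_sq_norm_le hν hab h h0 hf hF hE
  have h2 : (b - a) * (4 * Real.pi ^ 2 * ν * R) ^ 2 / (4 * Real.pi ^ 2 * ν) =
      (b - a) * (ν * (4 * Real.pi ^ 2 * R ^ 2)) := by
    rw [div_eq_iff (by positivity)]
    ring
  linarith [h1, h2]

/-- **Enstrophy of the ABC flow on the unit torus: `‖∇U‖₂² = 4π²(A² + B² + C²) = 4π²‖U‖₂²`** (first
Stokes shell: `ΔU = −4π²U`, `Torus.laplacian_abcFlow`; Green's identity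
`Torus.integral_inner_laplacian_self_eq_neg_gradNormSq`; `∫‖U‖² = A² + B² + C²`,
`Torus.integral_norm_sq_abcFlow`). -/
theorem gradNormSq_abcFlow (A B C : ℝ) :
    gradNormSq (Literature.Analysis.FluidPDE.Torus.abcFlow A B C) =
      4 * Real.pi ^ 2 * (A ^ 2 + B ^ 2 + C ^ 2) := by
  set U := Literature.Analysis.FluidPDE.Torus.abcFlow A B C with hU
  have hUs : IsSmooth U := Literature.Analysis.FluidPDE.Torus.isSmooth_abcFlow A B C
  have hG := Literature.Analysis.FluidPDE.Torus.integral_inner_laplacian_self_eq_neg_gradNormSq hUs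
  have hΔ : (fun x => ⟪laplacian U x, U x⟫_ℝ) = fun x => -(4 * Real.pi ^ 2) * ‖U x‖ ^ 2 := by
    funext x
    rw [hU, Literature.Analysis.FluidPDE.Torus.laplacian_abcFlow A B C x, inner_neg_left,
      real_inner_smul_left, real_inner_self_eq_norm_sq]
    ring
  rw [hΔ, integral_const_mul, hU, Literature.Analysis.FluidPDE.Torus.integral_norm_sq_abcFlow] at hG
  rw [hU]
  linarith

/-- **No recurrent state of the forced-ABC flow out-dissipates the laminar ABC flow on average.**
Let `U = Torus.abcFlow A B C` and let `(u, p)` be a classical solution on `[a, b] × T³`, `a < b`,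
`ν > 0`, of the Navier–Stokes system forced by the ABC host force `f = (ν·4π²)•U` (the force under
which `U` itself is the exact steady solution, `Torus.isClassicalNSSolutionOn_abcFlow_forced`), with
mean-zero velocity slices. If `‖u(a)‖₂² ≤ ‖u(b)‖₂²` — in particular over one period of a
time-periodic solution, or between any two equal-energy instants — then
`ν ∫ₐᵇ ‖∇u(t)‖₂² dt ≤ (b − a)·ν‖∇U‖₂²`, i.e. the mean dissipation rate is at most the laminar one,
with equality for `u ≡ U`. -/
theorem nu_mul_integral_gradNormSq_le_abc {ν a b : ℝ} (hν : 0 < ν) (hab : a < b) (A B C : ℝ)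
    {u : ℝ → UnitAddTorus (Fin 3) → EuclideanSpace ℝ (Fin 3)} {p : ℝ → UnitAddTorus (Fin 3) → ℝ}
    (h : IsClassicalNSSolutionOn (Icc a b) ν
      (fun _ x => (ν * (4 * Real.pi ^ 2)) • Literature.Analysis.FluidPDE.Torus.abcFlow A B C x) u p)
    (h0 : ∀ t ∈ Icc a b, HasZeroMean (u t))
    (hE : ∫ x, ‖u a x‖ ^ 2 ≤ ∫ x, ‖u b x‖ ^ 2) :
    ν * ∫ t in a..b, gradNormSq (u t) ≤
      (b - a) * (ν * gradNormSq (Literature.Analysis.FluidPDE.Torus.abcFlow A B C)) := by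
  have hπ : 0 < Real.pi := Real.pi_pos
  set U := Literature.Analysis.FluidPDE.Torus.abcFlow A B C with hU
  have hUs : IsSmooth U := Literature.Analysis.FluidPDE.Torus.isSmooth_abcFlow A B C
  -- `R = ‖U‖₂ = √(A² + B² + C²)`
  set R : ℝ := Real.sqrt (A ^ 2 + B ^ 2 + C ^ 2) with hR
  have hR0 : 0 ≤ R := Real.sqrt_nonneg _
  have hR2 : R ^ 2 = A ^ 2 + B ^ 2 + C ^ 2 := Real.sq_sqrt (by positivity)
  -- the force slices are smooth and have `L²` norm exactly `4π²ν R`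
  have hfs : IsSmooth (fun x => (ν * (4 * Real.pi ^ 2)) • U x) := hUs.const_smul _
  have hfn : Real.sqrt (∫ x, ‖(ν * (4 * Real.pi ^ 2)) • U x‖ ^ 2) = 4 * Real.pi ^ 2 * ν * R := by
    have h1 : (fun x => ‖(ν * (4 * Real.pi ^ 2)) • U x‖ ^ 2) =
        fun x => (ν * (4 * Real.pi ^ 2)) ^ 2 * ‖U x‖ ^ 2 := by
      funext x
      rw [norm_smul, mul_pow, Real.norm_eq_abs, sq_abs]
    rw [h1, integral_const_mul, hU, Literature.Analysis.FluidPDE.Torus.integral_norm_sq_abcFlow,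
      ← hR2, ← mul_pow, Real.sqrt_sq (by positivity)]
    ring
  have hmain := nu_mul_integral_gradNormSq_le_host (R := R) hν hab h h0 (fun t _ => hfs)
    (fun t _ => le_of_eq hfn) hE
  rw [hU, gradNormSq_abcFlow A B C, ← hR2]
  exact hmain

/-! ### Addendum (same seat, same day): the exact window identity and the booked Z4 sentence
«mean relative enstrophy = mean projection on the host» ((cb)(3)) by decl name

With a force that is jointly smooth on `[a, b] × T^d` the slope `dE/dt = −ν‖∇u‖₂² + ∫⟪f, u⟫` is
continuous on `[a, b]` (`H¹` balance for `‖∇u‖₂²`, `IsSmoothSpaceTimeOn.continuousOn_integral` for the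
work term), so the fundamental theorem of calculus holds with EQUALITY
(`intervalIntegral.integral_eq_sub_of_hasDeriv_right_of_le`):

* `nu_mul_integral_gradNormSq_eq` — `ν ∫ₐᵇ ‖∇u‖₂² = ∫ₐᵇ (∫⟪f(t), u(t)⟫) dt + ½(‖u(a)‖₂² − ‖u(b)‖₂²)`;
* `nu_mul_integral_gradNormSq_eq_abc` — ABC host force `f = (ν·4π²)•U`:
  `ν ∫ₐᵇ ‖∇u‖₂² = ν·4π² ∫ₐᵇ (∫⟪U, u(t)⟫) dt + ½(‖u(a)‖₂² − ‖u(b)‖₂²)`;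
* `integral_gradNormSq_mul_eq_abc_of_sq_norm_eq` — on an EQUAL-ENERGY window (`‖u(a)‖₂ = ‖u(b)‖₂`;
  one period of a periodic solution): `(∫ₐᵇ ‖∇u‖₂²)·‖U‖₂² = ‖∇U‖₂² · ∫ₐᵇ ∫⟪U, u(t)⟫`, i.e. in the cell's
  reader notation `⟨Z/Z_U⟩_T = ⟨a⟩_T` with `a(t) := ∫⟪U, u(t)⟫/‖U‖₂²` — the sentence the lead booked for
  the (r10-3) E-row («mean projection on U = mean relative enstrophy on any periodic orbit of this
  MODEL», two engines: 0.209080); exact for the untruncated forced flow on `T³`, MODEL reading as above.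
WHAT THIS IS NOT: not NS blow-up evidence (identities valid for every classical forced solution). -/

/-- **The window energy identity of forced Navier–Stokes on `T^d`.** Let `(u, p)` solve the forced
system classically on `[a, b] × T^d`, `a < b`, with a force `f` jointly smooth on `[a, b] × T^d`. Then
`ν ∫ₐᵇ ‖∇u(t)‖₂² dt = ∫ₐᵇ (∫ ⟪f(t), u(t)⟫) dt + ½(‖u(a)‖₂² − ‖u(b)‖₂²)`. -/
theorem nu_mul_integral_gradNormSq_eq {ν a b : ℝ} (hab : a < b)
    {f u : ℝ → UnitAddTorus d → EuclideanSpace ℝ d} {p : ℝ → UnitAddTorus d → ℝ}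
    (h : IsClassicalNSSolutionOn (Icc a b) ν f u p) (hfst : IsSmoothSpaceTimeOn (Icc a b) f) :
    ν * ∫ t in a..b, gradNormSq (u t) =
      (∫ t in a..b, ∫ x, ⟪f t x, u t x⟫_ℝ) + 2⁻¹ * ((∫ x, ‖u a x‖ ^ 2) - ∫ x, ‖u b x‖ ^ 2) := by
  set E : ℝ → ℝ := fun s => kineticEnergy (u s) with hEdef
  set E' : ℝ → ℝ := fun s => -ν * gradNormSq (u s) + ∫ x, ⟪f s x, u s x⟫_ℝ with hE'def
  have hder : ∀ s ∈ Icc a b, HasDerivWithinAt E (E' s) (Icc a b) s := fun s hs =>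
    IsClassicalNSSolutionOn.energy_balance_holds h (convex_Icc a b) hs
  have hcont : ContinuousOn E (Icc a b) := fun s hs => (hder s hs).continuousWithinAt
  have hderiv : ∀ s ∈ Ioo a b, HasDerivWithinAt E (E' s) (Ioi s) s := fun s hs =>
    ((hder s (Ioo_subset_Icc_self hs)).hasDerivAt (Icc_mem_nhds hs.1 hs.2)).hasDerivWithinAt
  -- continuity of the two pieces of `E'` on `[a, b]`
  have hGc : ContinuousOn (fun s => gradNormSq (u s)) (Icc a b) := by
    intro s hs
    have h1 : ContinuousWithinAt (fun r => (2 : ℝ) * (2⁻¹ * gradNormSq (u r))) (Icc a b) s :=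
      continuousWithinAt_const.mul
        (Literature.Analysis.FunctionSpaces.Torus.IsClassicalNSSolutionOn.hasDerivWithinAt_half_gradNormSq
          h hab hs).continuousWithinAt
    refine h1.congr (fun r _ => ?_) ?_ <;> ring
  have hWc : ContinuousOn (fun s => ∫ x, ⟪f s x, u s x⟫_ℝ) (Icc a b) :=
    (hfst.inner h.smooth_velocity).continuousOn_integral (convex_Icc a b)
  have hGi : IntervalIntegrable (fun s => gradNormSq (u s)) volume a b :=
    hGc.intervalIntegrable_of_Icc hab.le
  have hWi : IntervalIntegrable (fun s => ∫ x, ⟪f s x, u s x⟫_ℝ) volume a b :=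
    hWc.intervalIntegrable_of_Icc hab.le
  have hE'i : IntervalIntegrable E' volume a b := (hGi.const_mul (-ν)).add hWi
  have hFTC := intervalIntegral.integral_eq_sub_of_hasDeriv_right_of_le hab.le hcont hderiv hE'i
  have hsplit : ∫ t in a..b, E' t =
      -ν * (∫ t in a..b, gradNormSq (u t)) + ∫ t in a..b, ∫ x, ⟪f t x, u t x⟫_ℝ := by
    rw [← intervalIntegral.integral_const_mul, ← intervalIntegral.integral_add (hGi.const_mul (-ν)) hWi]
  have hEa : E a = 2⁻¹ * ∫ x, ‖u a x‖ ^ 2 := rfl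
  have hEb : E b = 2⁻¹ * ∫ x, ‖u b x‖ ^ 2 := rfl
  rw [hsplit, hEa, hEb] at hFTC
  linarith

/-- **Window energy identity, ABC host force.** For a classical solution on `[a, b] × T³`, `a < b`,
of the Navier–Stokes system forced by `f = (ν·4π²)•U`, `U = Torus.abcFlow A B C`:
`ν ∫ₐᵇ ‖∇u(t)‖₂² dt = ν·4π² ∫ₐᵇ (∫ ⟪U, u(t)⟫) dt + ½(‖u(a)‖₂² − ‖u(b)‖₂²)`. -/
theorem nu_mul_integral_gradNormSq_eq_abc {ν a b : ℝ} (hab : a < b) (A B C : ℝ)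
    {u : ℝ → UnitAddTorus (Fin 3) → EuclideanSpace ℝ (Fin 3)} {p : ℝ → UnitAddTorus (Fin 3) → ℝ}
    (h : IsClassicalNSSolutionOn (Icc a b) ν
      (fun _ x => (ν * (4 * Real.pi ^ 2)) • Literature.Analysis.FluidPDE.Torus.abcFlow A B C x) u p) :
    ν * ∫ t in a..b, gradNormSq (u t) =
      ν * (4 * Real.pi ^ 2) *
          (∫ t in a..b, ∫ x, ⟪Literature.Analysis.FluidPDE.Torus.abcFlow A B C x, u t x⟫_ℝ) +
        2⁻¹ * ((∫ x, ‖u a x‖ ^ 2) - ∫ x, ‖u b x‖ ^ 2) := by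
  set U := Literature.Analysis.FluidPDE.Torus.abcFlow A B C with hU
  have hUs : IsSmooth U := Literature.Analysis.FluidPDE.Torus.isSmooth_abcFlow A B C
  have hfs : IsSmooth (fun x => (ν * (4 * Real.pi ^ 2)) • U x) := hUs.const_smul _
  have hfst : IsSmoothSpaceTimeOn (Icc a b) (fun _ x => (ν * (4 * Real.pi ^ 2)) • U x) :=
    isSmoothSpaceTimeOn_const hfs _
  have h1 := nu_mul_integral_gradNormSq_eq hab h hfst
  have hW : (fun t => ∫ x, ⟪(ν * (4 * Real.pi ^ 2)) • U x, u t x⟫_ℝ) =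
      fun t => ν * (4 * Real.pi ^ 2) * ∫ x, ⟪U x, u t x⟫_ℝ := by
    funext t
    rw [← integral_const_mul]
    refine integral_congr_ae (ae_of_all _ fun x => ?_)
    exact real_inner_smul_left _ _ _
  rw [hW, intervalIntegral.integral_const_mul] at h1
  exact h1

/-- **«Mean relative enstrophy = mean projection on the host» (lead RULING (cb)(3), by decl name).**
For a classical solution on `[a, b] × T³`, `a < b`, `ν > 0`, of the Navier–Stokes system forced by the
ABC host force `f = (ν·4π²)•U`, over any EQUAL-ENERGY window (`‖u(a)‖₂² = ‖u(b)‖₂²` — one period of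
a periodic solution, or any two equal-energy instants):
`(∫ₐᵇ ‖∇u(t)‖₂² dt) · ‖U‖₂² = ‖∇U‖₂² · ∫ₐᵇ (∫ ⟪U, u(t)⟫) dt`, i.e. `⟨Z/Z_U⟩ = ⟨a⟩` with
`Z = ‖∇u‖₂²`, `Z_U = ‖∇U‖₂²`, `a(t) = ∫⟪U, u(t)⟫/‖U‖₂²` (reader notation; the two-engine E-row of the
Z4-b calibration orbit printed both sides = 0.209080). -/
theorem integral_gradNormSq_mul_eq_abc_of_sq_norm_eq {ν a b : ℝ} (hν : 0 < ν) (hab : a < b)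
    (A B C : ℝ) {u : ℝ → UnitAddTorus (Fin 3) → EuclideanSpace ℝ (Fin 3)}
    {p : ℝ → UnitAddTorus (Fin 3) → ℝ}
    (h : IsClassicalNSSolutionOn (Icc a b) ν
      (fun _ x => (ν * (4 * Real.pi ^ 2)) • Literature.Analysis.FluidPDE.Torus.abcFlow A B C x) u p)
    (hE : ∫ x, ‖u a x‖ ^ 2 = ∫ x, ‖u b x‖ ^ 2) :
    (∫ t in a..b, gradNormSq (u t)) *
        ∫ x, ‖Literature.Analysis.FluidPDE.Torus.abcFlow A B C x‖ ^ 2 =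
      gradNormSq (Literature.Analysis.FluidPDE.Torus.abcFlow A B C) *
        ∫ t in a..b, ∫ x, ⟪Literature.Analysis.FluidPDE.Torus.abcFlow A B C x, u t x⟫_ℝ := by
  have h1 := nu_mul_integral_gradNormSq_eq_abc hab A B C h
  rw [hE, sub_self, mul_zero, add_zero] at h1
  -- cancel `ν > 0`
  have h2 : ∫ t in a..b, gradNormSq (u t) =
      4 * Real.pi ^ 2 *
        ∫ t in a..b, ∫ x, ⟪Literature.Analysis.FluidPDE.Torus.abcFlow A B C x, u t x⟫_ℝ := by
    have h3 : ν * ∫ t in a..b, gradNormSq (u t) =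
        ν * (4 * Real.pi ^ 2 *
          ∫ t in a..b, ∫ x, ⟪Literature.Analysis.FluidPDE.Torus.abcFlow A B C x, u t x⟫_ℝ) := by
      rw [h1]; ring
    exact mul_left_cancel₀ hν.ne' h3
  rw [h2, gradNormSq_abcFlow, Literature.Analysis.FluidPDE.Torus.integral_norm_sq_abcFlow]
  ring

end Summit.NavierStokesRegularity.FluidComputer.ForcedDissipationCeiling
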